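import Summits.RiemannHypothesis.RiemannHypothesis.Theorems.WeilColumnBSplineFourier
import HarnessLib

/-!
# B-spline densities: the tent in closed form, the uniform sup bound, continuity (RH-FREE; W0 of THETA-ASSIGN)

Cell `rh-explicit`, WEIL column, seat handoff-prove-2 gen12 (director I l.7347 (a); cc-s2-3 I l.7351 named this file and
these signatures).  Closes the one open hypothesis of the D1 assembly `WeilColumnThetaMajorantD1` /
`ThetaParams.norm_Θ_le` (`hcont : Continuous P.h`): the base case of the continuity induction for
`bsplineDensity c k` (`WeilColumnBSplineFourier`, p416577/p417164) is the TENT `unif_c ⋆ unif_c`, computed here in closed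
form, and the sup bound `‖bsplineDensity c k x‖ ≤ (2c)⁻¹` feeds the tree's inductive step `continuous_bsplineDensity_succ`.
Nothing here bears on the truth of RH.
-/

noncomputable section

set_option linter.dupNamespace false

open Complex Set MeasureTheory Filter
open scoped Real Topology

namespace Summit.RiemannHypothesis.RiemannHypothesis.Theorems.WeilColumn.ThetaMellin

open Literature.NumberTheory.LFunctions

/-! ## §1 The uniform density pointwise -/

/-- `unif_c u = (2c)⁻¹` on `[−c, c]`, `0` outside. -/
theorem unifDensity_apply (c u : ℝ) :
    unifDensity c u = if u ∈ Icc (-c) c then (((2 * c)⁻¹ : ℝ) : ℂ) else 0 := by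
  simp [unifDensity, indicatorConst, Set.indicator_apply]

/-- `‖unif_c u‖ ≤ (2c)⁻¹` for `c > 0`. -/
theorem norm_unifDensity_le {c : ℝ} (hc : 0 < c) (u : ℝ) : ‖unifDensity c u‖ ≤ (2 * c)⁻¹ := by
  rw [unifDensity_apply]
  split_ifs
  · rw [Complex.norm_real, Real.norm_of_nonneg (by positivity)]
  · rw [norm_zero]; positivity

/-- `∫ ‖unif_c‖ = 1` for `c > 0`. -/
theorem integral_norm_unifDensity {c : ℝ} (hc : 0 < c) : ∫ u, ‖unifDensity c u‖ = 1 := by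
  have h : (fun u ↦ ‖unifDensity c u‖) = (Icc (-c) c).indicator fun _ ↦ (2 * c)⁻¹ := by
    funext u
    rw [unifDensity_apply, Set.indicator_apply]
    split_ifs
    · rw [Complex.norm_real, Real.norm_of_nonneg (by positivity)]
    · rw [norm_zero]
  rw [h, integral_indicator_const _ measurableSet_Icc, Real.volume_real_Icc_of_le (by linarith), smul_eq_mul]
  field_simp
  ring

/-! ## §2 The tent `unif_c ⋆ unif_c` in closed form and its continuity -/

/-- **The tent in closed form**: `(unif_c ⋆ unif_c)(x) = (2c)⁻²·max(0, min(c, x+c) − max(−c, x−c))` (the length of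
`[−c,c] ∩ [x−c, x+c]`). [folklore] -/
theorem bsplineDensity_one_apply (c x : ℝ) :
    bsplineDensity c 1 x =
      (((2 * c)⁻¹ : ℝ) : ℂ) ^ 2 * ((max (min c (x + c) - max (-c) (x - c)) 0 : ℝ) : ℂ) := by
  have hdef : bsplineDensity c 1 = weilConv (unifDensity c) (unifDensity c) := rfl
  rw [hdef, weilConv_apply]
  -- the integrand is the indicator of `[max(−c, x−c), min(c, x+c)]` times the constant
  have hpt : ∀ u : ℝ, unifDensity c u * unifDensity c (x - u) =
      (Icc (max (-c) (x - c)) (min c (x + c))).indicator (fun _ ↦ (((2 * c)⁻¹ : ℝ) : ℂ) ^ 2) u := by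
    intro u
    rw [unifDensity_apply, unifDensity_apply, Set.indicator_apply]
    simp only [mem_Icc, max_le_iff, le_min_iff]
    by_cases h1 : -c ≤ u ∧ u ≤ c
    · by_cases h2 : -c ≤ x - u ∧ x - u ≤ c
      · rw [if_pos h1, if_pos h2, if_pos ⟨⟨h1.1, by linarith [h2.2]⟩, ⟨h1.2, by linarith [h2.1]⟩⟩]; ring
      · rw [if_pos h1, if_neg h2, mul_zero, if_neg]
        rintro ⟨⟨-, ha⟩, ⟨-, hb⟩⟩
        exact h2 ⟨by linarith, by linarith⟩
    · rw [if_neg h1, zero_mul, if_neg]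
      rintro ⟨⟨ha, -⟩, ⟨hb, -⟩⟩
      exact h1 ⟨ha, hb⟩
  simp_rw [hpt]
  rw [integral_indicator_const _ measurableSet_Icc, Real.volume_real_Icc, Complex.real_smul, mul_comm]

/-- **The tent is continuous** (W0 base case). [folklore] -/
theorem continuous_bsplineDensity_one (c : ℝ) : Continuous (bsplineDensity c 1) := by
  have h : bsplineDensity c 1 = fun x ↦
      (((2 * c)⁻¹ : ℝ) : ℂ) ^ 2 * ((max (min c (x + c) - max (-c) (x - c)) 0 : ℝ) : ℂ) :=
    funext (bsplineDensity_one_apply c)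
  rw [h]
  fun_prop

/-! ## §3 The uniform sup bound and continuity of every B-spline density -/

/-- **`‖bsplineDensity c k x‖ ≤ (2c)⁻¹`** for `c > 0` and all `k`, `x` (induction: `‖(unif ⋆ ρ)(x)‖ ≤ sup‖ρ‖·∫‖unif‖ = sup‖ρ‖`).
[folklore] -/
theorem norm_bsplineDensity_le {c : ℝ} (hc : 0 < c) : ∀ (k : ℕ) (x : ℝ), ‖bsplineDensity c k x‖ ≤ (2 * c)⁻¹
  | 0, x => norm_unifDensity_le hc x
  | k + 1, x => by
      have hdef : bsplineDensity c (k + 1) = weilConv (unifDensity c) (bsplineDensity c k) := rfl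
      rw [hdef, weilConv_apply]
      have hbound : ∀ᵐ u : ℝ, ‖unifDensity c u * bsplineDensity c k (x - u)‖ ≤ (2 * c)⁻¹ * ‖unifDensity c u‖ := by
        refine Eventually.of_forall fun u ↦ ?_
        rw [norm_mul, mul_comm]
        exact mul_le_mul_of_nonneg_right (norm_bsplineDensity_le hc k (x - u)) (norm_nonneg _)
      have hint : Integrable fun u ↦ (2 * c)⁻¹ * ‖unifDensity c u‖ := (integrable_unifDensity c).norm.const_mul _
      calc ‖∫ u, unifDensity c u * bsplineDensity c k (x - u)‖ ≤ ∫ u, (2 * c)⁻¹ * ‖unifDensity c u‖ :=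
            norm_integral_le_of_norm_le hint hbound
        _ = (2 * c)⁻¹ := by rw [integral_const_mul, integral_norm_unifDensity hc, mul_one]

/-- The range of `‖bsplineDensity c k ·‖` is bounded above (by `(2c)⁻¹`). -/
theorem bddAbove_range_norm_bsplineDensity {c : ℝ} (hc : 0 < c) (k : ℕ) :
    BddAbove (Set.range fun x ↦ ‖bsplineDensity c k x‖) :=
  ⟨(2 * c)⁻¹, by rintro _ ⟨x, rfl⟩; exact norm_bsplineDensity_le hc k x⟩

/-- **Every B-spline density of order `k ≥ 1` is continuous** (`c > 0`): induction from the tent with the tree's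
`continuous_bsplineDensity_succ`. [folklore] -/
theorem continuous_bsplineDensity {c : ℝ} (hc : 0 < c) : ∀ {k : ℕ}, 1 ≤ k → Continuous (bsplineDensity c k)
  | 0, h => absurd h (by norm_num)
  | 1, _ => continuous_bsplineDensity_one c
  | k + 2, _ => continuous_bsplineDensity_succ (k + 1) (continuous_bsplineDensity hc (k := k + 1) (by omega))
      (bddAbove_range_norm_bsplineDensity hc (k + 1))

/-- **The PART XIX profile is continuous for `m ≥ 2`** (`ε > 0`): the hypothesis `hcont` of `WeilColumnThetaMajorantD1` /
`ThetaParams.norm_Θ_le`, discharged. [folklore] -/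
theorem continuous_profile_of_two_le {c₁ m₀ c₂ ε α : ℝ} {m : ℕ} (hm : 2 ≤ m) (hε : 0 < ε) :
    Continuous (profile c₁ m₀ c₂ ε α m) := by
  have hc : 0 < ε / m := div_pos hε (by exact_mod_cast (by omega : 0 < m))
  exact continuous_profile (continuous_bsplineDensity hc (by omega)) (bddAbove_range_norm_bsplineDensity hc (m - 1))

end Summit.RiemannHypothesis.RiemannHypothesis.Theorems.WeilColumn.ThetaMellin

end
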